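import Summits.ABC.Analytic.RequirementsSharp
import Summits.ABC.Harvest.CalibrationFloorsShapes
import HarnessLib
import HarnessLib.Audit

/-!
# ABC — analytic / modular lens: the typed REQUIREMENTS TABLE for polynomial Szpiro over `ℚ` (IV): the
# ARCHIMEDEAN door «Szpiro at infinity» and the exact split of the height door

Cell `abc-an` (C1), seat `typ-1` (KEY TYP-AN3, plan item (A)). HONESTY: abc is not proved by any of this. A-PS
(`Summit.ABC.PolySzpiroRat`) is NOT abc — «NOT abc — POLY-SZPIRO(E)» (HUMAN D-0139/D-0140); typed ≠ proved; computed ≠ proved; a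
calibration is a FLOOR on explicit constants, never evidence for a statement.

## What this file types and why
Silverman 1986 (Prop. 1.1 with the proof of Cor. 2.3, p. 334; PROVED in the tree as `silverman1986_log_max_sub_height_holds`) gives, for a global minimal
model of `E/ℚ` with `M := max(|Δ_min|, |c₄|³)`, `C₀ ≤ log M − 12 h_F(E) ≤ 6 log(1 + log M) + C₁` with absolute constants. Since `j = c₄³/Δ`,
`M = |Δ_min| · max(1, |j|)` EXACTLY, i.e. `log M = log|Δ_min(E)| + log⁺|j_E|` (`log_max_abs_Δ_c₄_eq`, PROVED below). Hence the HEIGHT door R5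
(`PolyFaltingsHeightRat`, Frey's height conjecture / Pasten 2024 Conj. 3.1) SPLITS into the finite part — the A-PS sentence `log|Δ_min| ≤ K log N + C` — and
the archimedean part — Pasten's «Szpiro at infinity» `log⁺|j_E| ≤ K' log N_E + C'` (thesis 2014, Conj. 104, in `j`-currency via his Lemma 86
`Im τ_E = (1/2π) log⁺|j(τ_E)| + O(1)`), typed here as the door `SzpiroAtInfinityRatEff K C` / `SzpiroAtInfinityRat K` (= the binder form already calibrated
by cell `abc-harv` in `Summits/ABC/Harvest/CalibrationFloorsShapes.lean`, whose floors are CITED BY NAME, §2):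
* §3 `exists_twelve_mul_faltingsHeight_le`: `12 h_F(E) ≤ log|Δ_min(E)| + log⁺|j_E| + c` for EVERY `E/ℚ` (PROVED; the archimedean inequality the plan asked
  for is a THEOREM of the tree, not a support Prop), and the upper half `log|Δ_min| + log⁺|j| − 6 log(1 + log|Δ_min| + log⁺|j|) ≤ 12 h_F + c'` (PROVED).
* §4 edges BY NAME: `Summit.ABC.PolySzpiroRatEff K C → SzpiroAtInfinityRatEff K' C' → PolyFaltingsHeightRatEff ((K+K')/12) ((C+C'+c)/12)` (effective up to
  Silverman's absolute `c`), hence A-PS ∧ Szpiro-at-∞ ⇒ R5 ⇒ R1 modulo {modularity, `PolyManinRat μ`, `PeterssonUpperRat θ`}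
  (`polyModularDegreeRat_of_polySzpiroRatEff_of_szpiroAtInfinityRat`, exponent `(K+K')/6 + 2μ + 1 + θ`) — this closes the converse residual «A-PS ⟹ Height
  is NOT known (the archimedean `log⁺|j|` term)» of the census rows RC-4/RC-1 CONDITIONALLY on the new door (census word unchanged: restatement-side); and
  conversely R5 `K` ⇒ A-PS `12K` (S2, file I) ∧ `SzpiroAtInfinityRat (12K + ε)` (§4, PROVED): **R5 ⟺ A-PS ∧ Szpiro-at-∞ up to exponent bookkeeping.**
* §5 `szpiroAtInfinityRat_of_abc`: `ABC → SzpiroAtInfinityRat (6 + ε)` for every `ε > 0` (generalized Szpiro, Bombieri–Gubler 12.5.12 (a) ⇒ (c) PROVED in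
  the tree, and `log⁺|j| ≤ log M`), so the door is implied by abc like every row of the table; A-PS is NOT abc.

Not typed here (said so): an unconditional Danilov-type floor `¬ SzpiroAtInfinityRat K` for `K < 5` (Hall near-misses `0 < |x³ − y²| < 0.97 √x`, tree
`Literature.Barriers.ABC.HallExponentSharp`, give `|j| ≫ N⁵` along an infinite family, the reduction at `p ≥ 5` being multiplicative there) would need the
conductor–discriminant comparison for that family and is left to a successor; the single-datum floor `K > 15` at `C = 0` is §2.

References: [Silverman1986] Prop. 1.1, Cor. 2.3; [PastenThesis2014] Conj. 104, Lemma 86; [PastenShimura2024] §3, Conj. 3.1, Rem. 3.3;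
[BombieriGubler2006] Thm. 12.5.12; [MaiMurty1994]; [Frey1989].
-/

noncomputable section
namespace Summit.ABC.Analytic
open WeierstrassCurve
open Literature.NumberTheory.EllipticCurves Literature.NumberTheory.EllipticCurves.ModularForms

/-! ## §1 The archimedean door (proof-free Props, used only as hypotheses / targets) -/

/-- **RC-4/AUX converse door, effective form `(K, C)`: «Szpiro at infinity» over `ℚ`** — for every elliptic `E/ℚ` (any model `W`; `j` is an isomorphism
invariant, `WeierstrassCurve.variableChange_j`), `log⁺|j_E| ≤ K · log N_E + C` (`Real.posLog` of the real cast of Mathlib's `WeierstrassCurve.j`;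
`posLog (−x) = posLog x`, so this is `log max(1, |j_E|)`). Pasten, thesis (2014) §5.7 Conj. 104: «The bound `ϖ_E ≪ log N_E`, or equivalently
`Im(τ_E) ≪ log N_E`, holds for elliptic curves `E/ℚ`», in `j`-currency by his Lemma 86 (`Im τ_E = (1/2π) log⁺|j(τ_E)| + O(1)`, p. 101;
`ϖ_E = log⁺|j_E| + O(1)`, p. 107), with the exponent explicit; «We think about Conjecture 104 as the ‘Szpiro conjecture at infinity’: in the height
conjecture `h(E) ≪ log N_E` we can decompose `h(E)` into the contribution at finite primes (essentially `log|Δ_E|`) and the prime at infinity (`Im(τ_E)`),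
obtaining as consequences the Szpiro conjecture and Conjecture 104 respectively» (p. 106). THE archimedean term of the chain:
`12 h_F = log|Δ_min| + log⁺|j| + O(log log)` (Silverman 1986 Prop. 1.1 / Cor. 2.3; §3 below), so A-PS ∧ this door ⇒ R5 (§4; Pasten's «since
`h(E) ≪ log Δ_E + ϖ_E`», proof of Prop. 105). OPEN for every `K`: best printed `ϖ_E ≪ N_E^{1+ε}` for all `E/ℚ` (thesis Thm. 107, from
`ϖ_E ≪ h(E) ≪ N_E log N_E`, MP 2013 Thm. 7.1) and `exp(c log N_E · log₃ N_E / log₂ N_E)` on Frey curves (Matveev) — exponentially off `K log N`, like R5;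
implied by abc for `K > 6` (§5); enters ONLY the converse direction Szpiro ⇒ height ⇒ degree (harmless sign for A-PS: `log|Δ_min| < 12 h_F + 16` needs no
control of `|j|`). «NOT abc» (D-0139/D-0140): no A-PS or abc strength of its own. CALIBRATION (computed ≠ proved — a FLOOR on the admissible explicit
`(K, C)`, never evidence for the statement; natural logs): ENG-JINF kit job j287027 (cell abc-harv, seat eng-2; memo
`pub/abc-harv/eng/abc-harv-eng-2/jinf/memo.md` sha16 2d6630cba765072b) over ALL 3,064,705 curves `N < 500000` of Cremona's `ecdata`, `λ_j := log⁺|j|/log N`: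
`C = 0 ⇒ K ≥ 15.06`, attained at 11a2 (`N = 11`, `j = −52893159101157376/11`, `log⁺|j| = 36.109`; kernel floor
`Summit.ABC.Harvest.not_szpiroAtInfinity_zero_of_le`, §2); for `N ≥ 10⁴`: `K ≥ 7.445` at 138437c1 (`N = 13·23·463 = |Δ_min|`, `log⁺|j| = 88.14`, the largest
`|j|` in the table); least constants on the upper hull 11a3 → 11a2 → 138437c1 → 417582j1: `C_min(5) = 28.95`, `C_min(6) = 21.7` (`17.1` for `N ≥ 10⁴`),
`C_min(7) = 19.3`, `C_min(10) = 12.1`; band maxima of `λ_j` for `b = ⌊log₂ N⌋ = 13…18`: 6.99, 6.62, 7.13, 6.75, 7.45, 6.76 — FLAT (`+0.027 ± 0.081` per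
doubling): no growth signal for `K` in range; the `σ > 1` records are the large-`j` members of Frey–Hellegouarch classes of good abc triples («abc-quality
records in Frey costume»). E-A TERM CENSUS kit job j288171 (cell abc-an, seat eng-2; memo ec5a80605680697b; two-engine check abc-harv-eng-3 j288192):
writing `log|Δ_min| − 12 h_F = 12 log 2π + κ + A_∞` (`κ = sup_ℍ log(y⁶|Δ(τ)|) = −6.2011`, `A_∞ ≤ 0`, `A_∞ = −log⁺|j| + 6 log log⁺|j| + O(1)` as `|j| → ∞`),
the archimedean piece is SATURATED at the Szpiro records (top-1000-σ optimal curves: mean `T_arch = 14.74` of the ceiling `15.853`, `max P_arch = 0`) and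
LOAD-BEARING only for the converse: `min A_∞ = −65.44` nats at 417582bd1 (`μ = log deg φ/log N = 2.0746` yet `σ = 3.357`; same `|j|` as 417582j1), band
minima `−32.6 … −66.1` nats (`b = 13…18`) deepening in nats but FLAT in ratio units (`min P_arch = −3.45 … −5.58`, slope `−0.30 ± 1.73` per doubling) ⇒ no
growth signal for `K`; ENG-JINF's fit `12 h_F − log|Δ_min| = −11.04 + 0.99974·log⁺|j| − 5.9937·log log⁺|j|` (max residual `0.014`, `1.2·10⁶` curves; theory
`1`, `−6`) is §3 numerically. [cite: PastenThesis2014, Conj. 104 (p. 104), Lemma 86 (p. 101), §5.7 p. 106, Thm. 107] [cite: Silverman1986, Cor. 2.3] -/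
@[conjecture] def SzpiroAtInfinityRatEff (K C : ℝ) : Prop :=
  ∀ (W : WeierstrassCurve ℚ) [W.IsElliptic],
    Real.posLog ((W.j : ℚ) : ℝ) ≤ K * Real.log (W.conductorNorm ℤ) + C

/-- **RC-4/AUX converse door: «Szpiro at infinity» with exponent `K`** — `∃ C, ∀ E/ℚ, log⁺|j_E| ≤ K log N_E + C`; `∃ K, SzpiroAtInfinityRat K` is
Pasten's thesis Conj. 104 in `j`-currency. OPEN for every `K`; `ABC ⇒ SzpiroAtInfinityRat (6 + ε)` (§5). «NOT abc» (D-0139/D-0140). CALIBRATION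
(computed ≠ proved; ENG-JINF j287027, table under `SzpiroAtInfinityRatEff`): a witness needs `K ≥ 15.06` at `C = 0` (11a2; kernel: `K ≤ 15` refuted,
§2), `C ≥ 21.7` at `K = 6`, and `K ≥ 7.445` beyond `N ≥ 10⁴` at `C = 0` (138437c1); late-band maxima flat at `λ_j ≈ 7` — a floor on witnesses,
silent on truth. [cite: PastenThesis2014, Conj. 104 (p. 104)] -/
@[conjecture] def SzpiroAtInfinityRat (K : ℝ) : Prop :=
  ∃ C : ℝ, SzpiroAtInfinityRatEff K C

/-- Eff ⇒ ineffective (one line). [folklore] -/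
theorem szpiroAtInfinityRat_of_eff {K C : ℝ} (h : SzpiroAtInfinityRatEff K C) : SzpiroAtInfinityRat K := ⟨C, h⟩

/-- Monotonicity in the exponent: `K ≤ K'` and `SzpiroAtInfinityRatEff K C` give `SzpiroAtInfinityRatEff K' C` (`log N_E ≥ 0`). [folklore] -/
theorem SzpiroAtInfinityRatEff.mono {K K' C : ℝ} (h : SzpiroAtInfinityRatEff K C) (hK : K ≤ K') :
    SzpiroAtInfinityRatEff K' C := by
  intro W _
  have hN : (0 : ℝ) ≤ Real.log (W.conductorNorm ℤ) :=
    Real.log_nonneg (by exact_mod_cast conductorNorm_pos_holds W)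
  have := h W
  nlinarith

/-! ## §2 Floors BY NAME (cell abc-harv's kernel certificates from the datum 11a2; cited, not restated) -/

/-- **Floor, general form** (abc-harv `Summit.ABC.Harvest.not_szpiroAtInfinity_of_lt`, datum 11a2): every explicit pair with
`K log 11 + C < log(52893159101157376/11)` is dead on arrival. [cite: PastenThesis2014, Conj. 104 (p. 104)] [cite: CremonaAlgorithms1997, Table 1] -/
theorem not_szpiroAtInfinityRatEff_of_lt {K C : ℝ} (h : K * Real.log 11 + C < Real.log (52893159101157376 / 11)) :
    ¬ SzpiroAtInfinityRatEff K C :=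
  Summit.ABC.Harvest.not_szpiroAtInfinity_of_lt h

/-- **Floor at `C = 0`: `SzpiroAtInfinityRatEff K 0` is FALSE for every `K ≤ 15`** (abc-harv
`Summit.ABC.Harvest.not_szpiroAtInfinity_zero_of_le`, `11¹⁶ < 52893159101157376`). Silent on Conj. 104 itself (free constant).
[cite: PastenThesis2014, Conj. 104 (p. 104)] [cite: CremonaAlgorithms1997, Table 1] -/
theorem not_szpiroAtInfinityRatEff_zero_of_le {K : ℝ} (hK : K ≤ 15) : ¬ SzpiroAtInfinityRatEff K 0 :=
  Summit.ABC.Harvest.not_szpiroAtInfinity_zero_of_le hK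

/-! ## §3 The archimedean identity and Silverman's two-sided comparison, in `(Δ_min, j)`-currency (PROVED) -/

/-- **`log max(|Δ_min|, |c₄|³) = log|Δ_min| + log⁺|j|` on a global minimal model** (`j = c₄³/Δ`, so `max(|Δ|, |c₄|³) = |Δ| · max(1, |j|)`;
`|Δ_W| = W.minimalDiscriminantNorm ℤ` for `[W.IsGloballyMinimal]`). The dictionary between Silverman's `log max{|jΔ|, |Δ|}` (proof of
Cor. 2.3) and Pasten's `j`-currency. [cite: Silverman1986, Cor. 2.3 (proof, p. 334)] -/
theorem log_max_abs_Δ_c₄_eq (W : WeierstrassCurve ℚ) [W.IsElliptic] [W.IsGloballyMinimal] :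
    Real.log ((max |W.Δ| (|W.c₄| ^ 3) : ℚ) : ℝ) =
      Real.log (W.minimalDiscriminantNorm ℤ) + Real.posLog ((W.j : ℚ) : ℝ) := by
  have hΔ0 : W.Δ ≠ 0 := by rw [← W.coe_Δ']; exact W.Δ'.ne_zero
  have hj : W.j = W.c₄ ^ 3 / W.Δ := by
    rw [WeierstrassCurve.j, ← WeierstrassCurve.coe_Δ', Units.val_inv_eq_inv_val, div_eq_inv_mul]
  set d : ℝ := ((W.Δ : ℚ) : ℝ) with hd_def
  set c : ℝ := ((W.c₄ : ℚ) : ℝ) with hc_def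
  have hd : d ≠ 0 := by rw [hd_def]; exact_mod_cast hΔ0
  have hM : ((max |W.Δ| (|W.c₄| ^ 3) : ℚ) : ℝ) = max |d| (|c| ^ 3) := by
    rw [hd_def, hc_def]; push_cast; rfl
  have hjR : ((W.j : ℚ) : ℝ) = c ^ 3 / d := by rw [hj, hd_def, hc_def]; push_cast; rfl
  have hnorm : (W.minimalDiscriminantNorm ℤ : ℝ) = |d| := by
    rw [minimalDiscriminantNorm_int_eq_natAbs_minimalDiscriminantInt_holds W, Nat.cast_natAbs, Int.cast_abs,
      hd_def, ← cast_minimalDiscriminantInt W, Rat.cast_intCast]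
  rw [hM, hnorm, hjR]
  have hdpos : 0 < |d| := abs_pos.mpr hd
  have hmax : max |d| (|c| ^ 3) = |d| * max 1 |c ^ 3 / d| := by
    have h1 : |d| * |c ^ 3 / d| = |c| ^ 3 := by
      rw [abs_div, abs_pow]; field_simp
    rw [mul_max_of_nonneg _ _ hdpos.le, mul_one, h1]
  have hm0 : max 1 |c ^ 3 / d| ≠ 0 := (lt_of_lt_of_le one_pos (le_max_left _ _)).ne'
  rw [hmax, Real.log_mul hdpos.ne' hm0, ← Real.posLog_abs, Real.posLog_eq_log_max_one (abs_nonneg _)]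

/-- **The archimedean inequality, lower half (Silverman 1986 Prop. 1.1 / Cor. 2.3, PROVED): `12 h_F(E) ≤ log|Δ_min(E)| + log⁺|j_E| + c`
for every elliptic `E/ℚ` with ONE absolute constant `c`** (`= −C₀` of `silverman1986_log_max_sub_height_holds`; transported from a global
minimal model `V • W` by the invariance of `h_F`, `Δ_min` and `j`). This is the «height/period identity» the RC-4 converse needs, as a theorem of
the tree — no support Prop is introduced. [cite: Silverman1986, Prop. 1.1 and Cor. 2.3 (proof, p. 334)] -/
theorem exists_twelve_mul_faltingsHeight_le :
    ∃ c : ℝ, ∀ (W : WeierstrassCurve ℚ) [W.IsElliptic],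
      12 * W.faltingsHeight ≤ Real.log (W.minimalDiscriminantNorm ℤ) + Real.posLog ((W.j : ℚ) : ℝ) + c := by
  obtain ⟨C₀, C₁, hSil⟩ := silverman1986_log_max_sub_height_holds
  refine ⟨-C₀, fun W _ => ?_⟩
  obtain ⟨V, hV⟩ := hasGlobalMinimalModel_rat_holds W
  haveI := hV
  have hjW : (V • W).j = W.j := by simp
  rw [← faltingsHeight_smul W V, ← minimalDiscriminantNorm_smul_rat W V, ← hjW]
  obtain ⟨L, hL⟩ := exists_isNeronLatticeOf_holds ((V • W).baseChange ℂ)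
  have hh : (V • W).faltingsHeight = neronLatticeHeight L := by
    rw [(V • W).faltingsHeight_eq_neg_half_log_covolume hL, neronLatticeHeight]
  have hlow := (hSil (V • W) L hL).1
  rw [log_max_abs_Δ_c₄_eq (V • W)] at hlow
  rw [hh]
  linarith

/-- **The archimedean inequality, upper half (Silverman 1986 Cor. 2.3, PROVED):
`log|Δ_min| + log⁺|j| − 6 log(1 + log|Δ_min| + log⁺|j|) ≤ 12 h_F + c'`** for every elliptic `E/ℚ` (`c' = C₁`). With the lower half:
`12 h_F = log|Δ_min| + log⁺|j| + O(log log)` — the height door is the finite door plus the archimedean door, exactly.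
[cite: Silverman1986, Cor. 2.3 (proof, p. 334)] -/
theorem exists_log_add_posLog_sub_le_twelve_mul_faltingsHeight :
    ∃ c : ℝ, ∀ (W : WeierstrassCurve ℚ) [W.IsElliptic],
      Real.log (W.minimalDiscriminantNorm ℤ) + Real.posLog ((W.j : ℚ) : ℝ) -
          6 * Real.log (1 + (Real.log (W.minimalDiscriminantNorm ℤ) + Real.posLog ((W.j : ℚ) : ℝ))) ≤
        12 * W.faltingsHeight + c := by
  obtain ⟨C₀, C₁, hSil⟩ := silverman1986_log_max_sub_height_holds
  refine ⟨C₁, fun W _ => ?_⟩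
  obtain ⟨V, hV⟩ := hasGlobalMinimalModel_rat_holds W
  haveI := hV
  have hjW : (V • W).j = W.j := by simp
  rw [← faltingsHeight_smul W V, ← minimalDiscriminantNorm_smul_rat W V, ← hjW]
  obtain ⟨L, hL⟩ := exists_isNeronLatticeOf_holds ((V • W).baseChange ℂ)
  have hh : (V • W).faltingsHeight = neronLatticeHeight L := by
    rw [(V • W).faltingsHeight_eq_neg_half_log_covolume hL, neronLatticeHeight]
  have hup := (hSil (V • W) L hL).2
  rw [log_max_abs_Δ_c₄_eq (V • W)] at hup
  rw [hh]
  linarith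

/-! ## §4 Edges BY NAME: A-PS ∧ Szpiro-at-∞ ⇒ R5 (⇒ R1 modulo Manin + Petersson upper + modularity); R5 ⇒ Szpiro-at-∞ -/

/-- **A-PS-eff ∧ Szpiro-at-∞-eff ⇒ R5-eff, effective up to ONE absolute constant**: there is an absolute `c` (Silverman's) with
`Summit.ABC.PolySzpiroRatEff K C → SzpiroAtInfinityRatEff K' C' → PolyFaltingsHeightRatEff ((K + K')/12) ((C + C' + c)/12)` for all
`K, C, K', C'` (`12 h_F ≤ log|Δ_min| + log⁺|j| + c ≤ (K + K') log N + (C + C' + c)`; Pasten's «since `h(E) ≪ log Δ_E + ϖ_E`», proof of Prop. 105,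
with constants). NOT abc; A-PS is NOT abc — «NOT abc — POLY-SZPIRO(E)». [cite: Silverman1986, Prop. 1.1 and Cor. 2.3]
[cite: PastenThesis2014, Prop. 105 (proof, p. 105)] -/
theorem exists_polyFaltingsHeightRatEff_of_polySzpiroRatEff_of_szpiroAtInfinityRatEff :
    ∃ c : ℝ, ∀ (K C K' C' : ℝ), Summit.ABC.PolySzpiroRatEff K C → SzpiroAtInfinityRatEff K' C' →
      PolyFaltingsHeightRatEff ((K + K') / 12) ((C + C' + c) / 12) := by
  obtain ⟨c, hc⟩ := exists_twelve_mul_faltingsHeight_le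
  refine ⟨c, fun K C K' C' hS hA W _ => ?_⟩
  have h1 := hS W
  have h2 := hA W
  have h3 := hc W
  have h12 : 12 * W.faltingsHeight ≤ (K + K') * Real.log (W.conductorNorm ℤ) + (C + C' + c) := by linarith
  linarith

/-- **A-PS-eff `(K, C)` ∧ `SzpiroAtInfinityRat K'` ⇒ `PolyFaltingsHeightRat ((K + K')/12)`** (R5 with the explicit exponent). So the census
residual «A-PS ⟹ Height is NOT known (the archimedean `log⁺|j|` term)» is closed CONDITIONALLY on the archimedean door, with no other input.
NOT abc. [cite: Silverman1986, Cor. 2.3] [cite: PastenShimura2024, Conj. 3.1] -/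
theorem polyFaltingsHeightRat_of_polySzpiroRatEff_of_szpiroAtInfinityRat {K C K' : ℝ}
    (hS : Summit.ABC.PolySzpiroRatEff K C) (hA : SzpiroAtInfinityRat K') : PolyFaltingsHeightRat ((K + K') / 12) := by
  obtain ⟨c, hc⟩ := exists_polyFaltingsHeightRatEff_of_polySzpiroRatEff_of_szpiroAtInfinityRatEff
  obtain ⟨C', hA⟩ := hA
  exact ⟨_, hc K C K' C' hS hA⟩

/-- **A-PS ∧ Szpiro-at-∞ ⇒ the Height conjecture** (`∃ κ, PolyFaltingsHeightRat κ`, which is `Summit.ABC.Harvest.HeightConjecture` by the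
PROVED bridge `Summit.ABC.Harvest.heightConjecture_iff_exists_polyFaltingsHeightRat` — not imported here, Theses cone). NOT abc.
[cite: PastenShimura2024, Conj. 3.1 and Rem. 3.3] -/
theorem exists_polyFaltingsHeightRat_of_polySzpiroRat_of_szpiroAtInfinityRat {K' : ℝ}
    (hS : Summit.ABC.PolySzpiroRat) (hA : SzpiroAtInfinityRat K') : ∃ κ : ℝ, PolyFaltingsHeightRat κ := by
  obtain ⟨K, C, hS⟩ := hS
  exact ⟨_, polyFaltingsHeightRat_of_polySzpiroRatEff_of_szpiroAtInfinityRat hS hA⟩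

/-- **A-PS ∧ Szpiro-at-∞ ⇒ R1 (polynomial modular degree), modulo exactly the converse inputs of file II** — modularity
(`nonempty_modularParametrizationData`, KNOWN named fact), `PolyManinRat μ`, `PeterssonUpperRat θ`: exponent `(K + K')/6 + 2μ + 1 + θ`
(§4 then `polyModularDegreeRat_of_polyFaltingsHeightRat_of_manin_of_petersson`, Zagier read backwards). The full converse chain
Szpiro ⇒ height ⇒ degree of Frey 1989 / Mai–Murty 1994 / Pasten 2024 Rem. 3.3 with every input named. NOT abc.
[cite: MaiMurty1994] [cite: PastenShimura2024, Rem. 3.3] -/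
theorem polyModularDegreeRat_of_polySzpiroRatEff_of_szpiroAtInfinityRat {K C K' μ θ : ℝ}
    (hmod : nonempty_modularParametrizationData) (hS : Summit.ABC.PolySzpiroRatEff K C) (hA : SzpiroAtInfinityRat K')
    (hM : PolyManinRat μ) (hU : PeterssonUpperRat θ) : PolyModularDegreeRat ((K + K') / 6 + 2 * μ + 1 + θ) := by
  have h := polyModularDegreeRat_of_polyFaltingsHeightRat_of_manin_of_petersson hmod
    (polyFaltingsHeightRat_of_polySzpiroRatEff_of_szpiroAtInfinityRat hS hA) hM hU
  have : 2 * ((K + K') / 12) + 2 * μ + 1 + θ = (K + K') / 6 + 2 * μ + 1 + θ := by ring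
  rw [this] at h
  exact h

/-- **R5 ⇒ Szpiro-at-∞ (PROVED): `PolyFaltingsHeightRat K → SzpiroAtInfinityRat (12K + ε)` for every `ε > 0`** — the upper half of
Silverman's comparison (`log M − 6 log(1 + log M) ≤ 12 h_F + C₁`, `log⁺|j| ≤ log M`) with the `log log` absorbed into `ε` by the tangent-line
bound `6 log(1 + x) ≤ a x + 6 log(6/a) + a − 6`; for `K ≤ ½` the hypothesis is refuted (`not_polyFaltingsHeightRat_of_le_half`, Masser). With S2
(`PolyFaltingsHeightRat K →` A-PS `12K`, file I) and §4: **R5 ⟺ A-PS ∧ Szpiro-at-∞** up to the exponent bookkeeping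
`(K, K') ↦ (K + K')/12 ↦ (K + K', K + K' + ε)` — Pasten: «a weak version of the height conjecture (namely `h(E) ≪ log N_E`) implies this
conjecture» (p. 104), here with exponents. NOT abc. [cite: Silverman1986, Cor. 2.3 (proof, p. 334)] [cite: PastenThesis2014, §5.7 (p. 104 and p. 106)] -/
theorem szpiroAtInfinityRat_of_polyFaltingsHeightRat {K ε : ℝ} (hε : 0 < ε) (h : PolyFaltingsHeightRat K) :
    SzpiroAtInfinityRat (12 * K + ε) := by
  rcases le_or_gt K (1 / 2) with hK | hK
  · exact absurd h (not_polyFaltingsHeightRat_of_le_half hK)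
  obtain ⟨C, hC⟩ := h
  obtain ⟨c₁, hc₁⟩ := exists_log_add_posLog_sub_le_twelve_mul_faltingsHeight
  set s : ℝ := 12 * K with hs
  set t : ℝ := 12 * K + ε with ht
  have hspos : 0 < s := by rw [hs]; linarith
  have htpos : 0 < t := by rw [ht]; linarith
  set a : ℝ := ε / t with ha
  have hapos : 0 < a := div_pos hε htpos
  set A : ℝ := 6 / a with hA
  have hApos : 0 < A := div_pos (by norm_num) hapos
  set D : ℝ := 6 * Real.log A + a - 6 with hD
  refine ⟨t * (12 * C + c₁ + D) / s, fun W _ => ?_⟩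
  set x : ℝ := Real.log (W.minimalDiscriminantNorm ℤ) + Real.posLog ((W.j : ℚ) : ℝ) with hx
  have hΔnn : 0 ≤ Real.log (W.minimalDiscriminantNorm ℤ) :=
    Real.log_nonneg (by exact_mod_cast minimalDiscriminantNorm_pos_holds W)
  have hxnn : 0 ≤ x := add_nonneg hΔnn Real.posLog_nonneg
  have hup : x - 6 * Real.log (1 + x) ≤ 12 * W.faltingsHeight + c₁ := hc₁ W
  -- tangent line at `A = 6/a`: `6 log(1 + x) ≤ a x + D`
  have htan : 6 * Real.log (1 + x) ≤ a * x + D := by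
    have h1 : Real.log ((1 + x) / A) ≤ (1 + x) / A - 1 := Real.log_le_sub_one_of_pos (by positivity)
    rw [Real.log_div (by positivity) hApos.ne'] at h1
    have h6A : 6 * ((1 + x) / A) = a * (1 + x) := by rw [hA]; field_simp
    rw [hD]
    linarith
  have hh : W.faltingsHeight ≤ K * Real.log (W.conductorNorm ℤ) + C := hC W
  -- `(t − ε) x = s x ≤ t (12 h + c₁ + D) ≤ s · t log N + t (12 C + c₁ + D)`
  have hta : t * a = ε := by rw [ha]; field_simp
  have key : s * x ≤ t * (12 * W.faltingsHeight + c₁ + D) := by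
    have h1 : t * (x - 12 * W.faltingsHeight - c₁) ≤ t * (a * x + D) :=
      mul_le_mul_of_nonneg_left (by linarith) htpos.le
    have hst : s = t - ε := by rw [hs, ht]; ring
    rw [hst]
    nlinarith [h1, hta]
  have key2 : s * x ≤ s * (t * Real.log (W.conductorNorm ℤ)) + t * (12 * C + c₁ + D) := by
    have h1 : t * (12 * W.faltingsHeight) ≤ t * (12 * (K * Real.log (W.conductorNorm ℤ) + C)) :=
      mul_le_mul_of_nonneg_left (by linarith) htpos.le
    have h2 : t * (12 * (K * Real.log (W.conductorNorm ℤ) + C)) =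
        s * (t * Real.log (W.conductorNorm ℤ)) + t * (12 * C) := by rw [hs]; ring
    nlinarith [key, h1, h2]
  have key3 : x - t * Real.log (W.conductorNorm ℤ) ≤ t * (12 * C + c₁ + D) / s := by
    rw [le_div_iff₀ hspos]
    nlinarith [key2]
  have hjx : Real.posLog ((W.j : ℚ) : ℝ) ≤ x := by rw [hx]; linarith
  linarith

/-! ## §5 ABC ⇒ Szpiro-at-∞ with exponent `6 + ε` (generalized Szpiro; PROVED equivalence in the tree) -/

/-- **`ABC → SzpiroAtInfinityRat (6 + ε)` for every `ε > 0`, unconditionally in the kernel**: abc (`≤`-form) ⇒ Bombieri–Gubler's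
generalized Szpiro `max(|Δ_min|, |c₄|³) ≤ C(ε) N^{6+ε}` (Thm. 12.5.12 (a) ⇒ (b) strong Hall ⇒ (c), PROVED `abcLe_iff_generalizedSzpiroBG_holds`: abc on
`c₆² + 1728Δ = c₄³` cleared of common factors) on a global minimal model, and `log⁺|j| = log max − log|Δ_min| ≤ log max` (§3). So the archimedean
door, like every row of the table, is implied by abc (exponent `6 + ε` on the Hall line); A-PS is NOT abc; this is not a door to abc.
[cite: BombieriGubler2006, Thm. 12.5.12] [cite: Silverman1986, Cor. 2.3] -/
theorem szpiroAtInfinityRat_of_abc (habc : ABC) {ε : ℝ} (hε : 0 < ε) : SzpiroAtInfinityRat (6 + ε) := by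
  have hle : ∀ ε : ℝ, 0 < ε → ∃ C : ℝ, ∀ a b c : ℕ,
      Literature.NumberTheory.DiophantineGeometry.IsABCTriple a b c →
        (c : ℝ) ≤ C * ((Literature.NumberTheory.DiophantineGeometry.rad a b c : ℕ) : ℝ) ^ (1 + ε) := by
    intro ε hε
    obtain ⟨C, -, hC⟩ := (ABC_iff.mp habc) ε hε
    exact ⟨C, fun a b c h => (hC a b c h).le⟩
  have hS : GeneralizedSzpiroConjectureBG := abcLe_iff_generalizedSzpiroBG_holds.mp hle
  obtain ⟨C, hC⟩ := hS ε hε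
  refine ⟨Real.log (max C 1), fun W _ => ?_⟩
  obtain ⟨V, hV⟩ := hasGlobalMinimalModel_rat_holds W
  haveI := hV
  have hjW : (V • W).j = W.j := by simp
  rw [← conductorNorm_smul_rat W V, ← hjW]
  set W' : WeierstrassCurve ℚ := V • W with hW'
  set W₀ : WeierstrassCurve ℤ := integralModelInt W' with hW₀
  have hW₀W : W₀.baseChange ℚ = W' := baseChange_integralModelInt W'
  have hell : (W₀.baseChange ℚ).IsElliptic := by rw [hW₀W]; infer_instance
  have hmin : ∀ v : IsDedekindDomain.HeightOneSpectrum ℤ, (W₀.baseChange ℚ).IsMinimalAt v :=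
    fun v => by rw [hW₀W]; exact IsGloballyMinimal.isMinimalAt_int W' v
  have hBG := hC W₀ hell hmin
  rw [hW₀W] at hBG
  have hq : (max |W'.Δ| (|W'.c₄| ^ 3) : ℚ) = ((max |W₀.Δ| (|W₀.c₄| ^ 3) : ℤ) : ℚ) := by
    rw [← cast_integralModelInt_Δ W', ← cast_integralModelInt_c₄ W']
    push_cast
    rfl
  have hM : ((max |W'.Δ| (|W'.c₄| ^ 3) : ℚ) : ℝ) = ((max |W₀.Δ| (|W₀.c₄| ^ 3) : ℤ) : ℝ) := by
    rw [hq, Rat.cast_intCast]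
  have hM1 : (1 : ℝ) ≤ ((max |W'.Δ| (|W'.c₄| ^ 3) : ℚ) : ℝ) := one_le_max_abs_Δ_c4 W'
  have hN : (0 : ℝ) < (W'.conductorNorm ℤ : ℝ) := by exact_mod_cast conductorNorm_pos_holds W'
  have hC1 : (0 : ℝ) < max C 1 := lt_max_of_lt_right one_pos
  have hMle : ((max |W'.Δ| (|W'.c₄| ^ 3) : ℚ) : ℝ) ≤ max C 1 * (W'.conductorNorm ℤ : ℝ) ^ (6 + ε) := by
    rw [hM]
    exact hBG.trans (mul_le_mul_of_nonneg_right (le_max_left _ _) (Real.rpow_nonneg hN.le _))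
  have hlogM : Real.log ((max |W'.Δ| (|W'.c₄| ^ 3) : ℚ) : ℝ) ≤
      Real.log (max C 1) + (6 + ε) * Real.log (W'.conductorNorm ℤ : ℝ) := by
    have := Real.log_le_log (by linarith) hMle
    rwa [Real.log_mul hC1.ne' (Real.rpow_pos_of_pos hN _).ne', Real.log_rpow hN] at this
  rw [log_max_abs_Δ_c₄_eq W'] at hlogM
  have hΔnn : 0 ≤ Real.log (W'.minimalDiscriminantNorm ℤ) :=
    Real.log_nonneg (by exact_mod_cast minimalDiscriminantNorm_pos_holds W')
  linarith

end Summit.ABC.Analytic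
end
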